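import Mathlib
import Summits.Ventures.PercRepro2.A3WithinCondExp

/-!
# The within-cluster half: the fibre slacks as the mean conditional covariance given `C(a₃)`, and
the law of total covariance on both sides of (HCOV) (blind cell PercRepro2, typer-1 g17; p5 g12's
`A3Fibre.lean` / `A3FibreMain.lean`; parts I–IV-a; the lead's word 2026-08-26T22:16:25Z — part IV-b)

With `𝒢 = σ(C(a₃))`, `μ_A = (percMeasureOf p hp)[|A]` and the fibre covariance masses `fibreCov`
of part IV-a (`A3WithinCondExp.lean`):

* **`sum_slack_div_eq_sum_fibreCov`**: p5's within-cluster sum `∑_W slack W / m_W` is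
  `∑_W fibreCov_Q(σ_b, F) W − ∑_W fibreCov_PD(1_{b∈U}, 1_{o∈U}) W` — for every weight vector
  (the fibre masses of `σ_b σ_o`, `σ_b 1_{o∈U}`, `1_{b∈U} 1_{o∈U}` and `σ_b F` are the four-term atoms
  of p5's `slack`; a null fibre gives `0 = 0 − 0`);
* **`sum_slack_div_eq_integral_condCovSigma`**: hence
  `∑_W slack W / m_W = P(Q) · μ_Q[Cov(σ_b, F | 𝒢)] − P(PD) · μ_PD[Cov(1_{b∈U}, 1_{o∈U} | 𝒢)]` — the
  within-cluster companion of `btw_eq_covariance'`;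
* **`covariance_eq_integral_condCovSigma_add_covariance_condExp`**: the **law of total covariance**
  on the conditioned product measure,
  `cov[f, g; μ_A] = μ_A[Cov(f, g | 𝒢)] + cov[μ_A[f | 𝒢], μ_A[g | 𝒢]; μ_A]` (every weight vector);
* **`sum_slack_div_add_btw_eq_covariance`**: `∑_W slack W / m_W + btw = P(Q) · cov[σ_b, F; μ_Q] −
  P(PD) · cov[1_{b∈U}, 1_{o∈U}; μ_PD]` — within + between on both sides of (HCOV), for every weight
  vector — and **`Gc_eq_a3_of_total_covariance`**, p5's a₃-exploration identity
  `Gc = P(PD) · P(Q) · (∑_W slack W / m_W + btw)` re-derived from `Gc_eq_covariance` through it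
  (a second, measure-theoretic proof of `A3FibreMain.Gc_eq_a3`).

A LANGUAGE line (identities): nothing is claimed about the sign of any term; the crux of record and
the residual (MEANS-a₃) are unmoved.
-/

namespace Summit.Ventures.PercRepro2

open UnionCluster MeasureTheory ProbabilityTheory MeasureBridge

namespace CovForm

namespace A3Means

/-! ## The fibre slacks of `A3Fibre.lean` as fibre covariance masses -/

section Slack

variable {V : Type*} {E : Type*} [Fintype V] [DecidableEq V] [Fintype E] [DecidableEq E]

omit [Fintype V] [DecidableEq V] in
/-- The `Q`-fibre mass of `σ_b σ_o`: the four-term atom `Sbo` of p5's `slack`. -/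
lemma fibreExpect_Q_sigma_mul_sigma (p : E → ℝ) (ends : E → Sym2 V) (o a₁ a₂ a₃ b : V)
    (W : Finset V) :
    fibreExpect p ends a₃ (avoidAll ends a₂ {a₁})
        (fun ω => sigma ends a₁ a₂ b ω * sigma ends a₁ a₂ o ω) W =
      prob p (A3Fibre.fibre ends a₁ a₂ a₃ W ∩ (connEvent ends a₁ b ∩ connEvent ends a₁ o)) +
        prob p (A3Fibre.fibre ends a₁ a₂ a₃ W ∩ (connEvent ends a₂ b ∩ connEvent ends a₂ o)) -
        prob p (A3Fibre.fibre ends a₁ a₂ a₃ W ∩ (connEvent ends a₁ b ∩ connEvent ends a₂ o)) -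
        prob p (A3Fibre.fibre ends a₁ a₂ a₃ W ∩ (connEvent ends a₂ b ∩ connEvent ends a₁ o)) := by
  unfold fibreExpect A3Fibre.fibre
  rw [← expect_ind3, ← expect_ind3, ← expect_ind3, ← expect_ind3]
  unfold expect
  simp only [← Finset.sum_add_distrib, ← Finset.sum_sub_distrib]
  refine Finset.sum_congr rfl fun ω _ => ?_
  simp only [sigma, iL, iH]
  ring

omit [Fintype V] [DecidableEq V] in
/-- The `Q`-fibre mass of `σ_b 1_{o∈U}`: the four-term atom `Sbuo` of p5's `slack`. -/
lemma fibreExpect_Q_sigma_mul_inU (p : E → ℝ) (ends : E → Sym2 V) (o a₁ a₂ a₃ b : V)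
    (W : Finset V) :
    fibreExpect p ends a₃ (avoidAll ends a₂ {a₁})
        (fun ω => sigma ends a₁ a₂ b ω * inU ends a₁ a₂ o ω) W =
      prob p (A3Fibre.fibre ends a₁ a₂ a₃ W ∩ (connEvent ends a₁ b ∩ connEvent ends a₁ o)) +
        prob p (A3Fibre.fibre ends a₁ a₂ a₃ W ∩ (connEvent ends a₁ b ∩ connEvent ends a₂ o)) -
        prob p (A3Fibre.fibre ends a₁ a₂ a₃ W ∩ (connEvent ends a₂ b ∩ connEvent ends a₁ o)) -
        prob p (A3Fibre.fibre ends a₁ a₂ a₃ W ∩ (connEvent ends a₂ b ∩ connEvent ends a₂ o)) := by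
  unfold fibreExpect A3Fibre.fibre
  rw [← expect_ind3, ← expect_ind3, ← expect_ind3, ← expect_ind3]
  unfold expect
  simp only [← Finset.sum_add_distrib, ← Finset.sum_sub_distrib]
  refine Finset.sum_congr rfl fun ω _ => ?_
  simp only [sigma, inU, iL, iH]
  ring

omit [Fintype V] [DecidableEq V] in
/-- The `Q`-fibre mass of `1_{b∈U} 1_{o∈U}`: the four-term atom `Sbuo'` of p5's `slack`. -/
lemma fibreExpect_Q_inU_mul_inU (p : E → ℝ) (ends : E → Sym2 V) (o a₁ a₂ a₃ b : V)
    (W : Finset V) :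
    fibreExpect p ends a₃ (avoidAll ends a₂ {a₁})
        (fun ω => inU ends a₁ a₂ b ω * inU ends a₁ a₂ o ω) W =
      prob p (A3Fibre.fibre ends a₁ a₂ a₃ W ∩ (connEvent ends a₁ b ∩ connEvent ends a₁ o)) +
        prob p (A3Fibre.fibre ends a₁ a₂ a₃ W ∩ (connEvent ends a₁ b ∩ connEvent ends a₂ o)) +
        prob p (A3Fibre.fibre ends a₁ a₂ a₃ W ∩ (connEvent ends a₂ b ∩ connEvent ends a₁ o)) +
        prob p (A3Fibre.fibre ends a₁ a₂ a₃ W ∩ (connEvent ends a₂ b ∩ connEvent ends a₂ o)) := by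
  unfold fibreExpect A3Fibre.fibre
  rw [← expect_ind3, ← expect_ind3, ← expect_ind3, ← expect_ind3]
  unfold expect
  simp only [← Finset.sum_add_distrib]
  refine Finset.sum_congr rfl fun ω _ => ?_
  simp only [inU, iL, iH]
  ring

omit [Fintype V] in
/-- The `Q`-fibre mass of `σ_b F` is the atom `S_{σ_b F}` of p5's `slack`
(`σ₃ = s3 W` on the fibre). -/
lemma fibreExpect_Q_sigma_mul_F (p : E → ℝ) (ends : E → Sym2 V) (o a₁ a₂ a₃ b : V)
    (W : Finset V) :
    fibreExpect p ends a₃ (avoidAll ends a₂ {a₁})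
        (fun ω => sigma ends a₁ a₂ b ω * Ffun ends o a₁ a₂ a₃ (gamma p ends o a₁ a₂ a₃) ω) W =
      (prob p (A3Fibre.fibre ends a₁ a₂ a₃ W ∩ (connEvent ends a₁ b ∩ connEvent ends a₁ o)) +
        prob p (A3Fibre.fibre ends a₁ a₂ a₃ W ∩ (connEvent ends a₂ b ∩ connEvent ends a₂ o)) -
        prob p (A3Fibre.fibre ends a₁ a₂ a₃ W ∩ (connEvent ends a₁ b ∩ connEvent ends a₂ o)) -
        prob p (A3Fibre.fibre ends a₁ a₂ a₃ W ∩ (connEvent ends a₂ b ∩ connEvent ends a₁ o))) +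
      A3Fibre.s3 a₁ a₂ W *
        (A3Fibre.gamma p ends o a₁ a₂ a₃ * A3Fibre.Ssig p ends a₁ a₂ a₃ b W -
          (prob p (A3Fibre.fibre ends a₁ a₂ a₃ W ∩ (connEvent ends a₁ b ∩ connEvent ends a₁ o)) +
            prob p (A3Fibre.fibre ends a₁ a₂ a₃ W ∩ (connEvent ends a₁ b ∩ connEvent ends a₂ o)) -
            prob p (A3Fibre.fibre ends a₁ a₂ a₃ W ∩ (connEvent ends a₂ b ∩ connEvent ends a₁ o)) -
            prob p (A3Fibre.fibre ends a₁ a₂ a₃ W ∩ (connEvent ends a₂ b ∩ connEvent ends a₂ o)))) := by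
  have key : (fun ω => (A3Fibre.fibre ends a₁ a₂ a₃ W).indicator 1 ω *
      (sigma ends a₁ a₂ b ω * Ffun ends o a₁ a₂ a₃ (gamma p ends o a₁ a₂ a₃) ω)) =
      fun ω => (A3Fibre.fibre ends a₁ a₂ a₃ W).indicator 1 ω *
          (sigma ends a₁ a₂ b ω * sigma ends a₁ a₂ o ω) +
        A3Fibre.s3 a₁ a₂ W *
          ((A3Fibre.fibre ends a₁ a₂ a₃ W).indicator 1 ω *
            (gamma p ends o a₁ a₂ a₃ * sigma ends a₁ a₂ b ω -
              sigma ends a₁ a₂ b ω * inU ends a₁ a₂ o ω)) := by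
    funext ω
    by_cases hω : ω ∈ A3Fibre.fibre ends a₁ a₂ a₃ W
    · rw [Set.indicator_of_mem hω, Ffun, sigma_a3_eq_s3 hω]
      simp only [Pi.one_apply]
      ring
    · simp [Set.indicator_of_notMem hω]
  have h1 : expect p (fun ω => (A3Fibre.fibre ends a₁ a₂ a₃ W).indicator 1 ω *
      (sigma ends a₁ a₂ b ω * sigma ends a₁ a₂ o ω)) =
      prob p (A3Fibre.fibre ends a₁ a₂ a₃ W ∩ (connEvent ends a₁ b ∩ connEvent ends a₁ o)) +
        prob p (A3Fibre.fibre ends a₁ a₂ a₃ W ∩ (connEvent ends a₂ b ∩ connEvent ends a₂ o)) -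
        prob p (A3Fibre.fibre ends a₁ a₂ a₃ W ∩ (connEvent ends a₁ b ∩ connEvent ends a₂ o)) -
        prob p (A3Fibre.fibre ends a₁ a₂ a₃ W ∩ (connEvent ends a₂ b ∩ connEvent ends a₁ o)) :=
    fibreExpect_Q_sigma_mul_sigma p ends o a₁ a₂ a₃ b W
  have h2 : expect p (fun ω => (A3Fibre.fibre ends a₁ a₂ a₃ W).indicator 1 ω *
      (gamma p ends o a₁ a₂ a₃ * sigma ends a₁ a₂ b ω - sigma ends a₁ a₂ b ω * inU ends a₁ a₂ o ω)) =
      gamma p ends o a₁ a₂ a₃ * A3Fibre.Ssig p ends a₁ a₂ a₃ b W -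
        (prob p (A3Fibre.fibre ends a₁ a₂ a₃ W ∩ (connEvent ends a₁ b ∩ connEvent ends a₁ o)) +
          prob p (A3Fibre.fibre ends a₁ a₂ a₃ W ∩ (connEvent ends a₁ b ∩ connEvent ends a₂ o)) -
          prob p (A3Fibre.fibre ends a₁ a₂ a₃ W ∩ (connEvent ends a₂ b ∩ connEvent ends a₁ o)) -
          prob p (A3Fibre.fibre ends a₁ a₂ a₃ W ∩ (connEvent ends a₂ b ∩ connEvent ends a₂ o))) := by
    rw [← fibreExpect_Q_sigma, ← fibreExpect_Q_sigma_mul_inU]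
    unfold fibreExpect A3Fibre.fibre expect
    rw [Finset.mul_sum, ← Finset.sum_sub_distrib]
    exact Finset.sum_congr rfl fun ω _ => by ring
  show expect p (fun ω => (A3Fibre.fibre ends a₁ a₂ a₃ W).indicator 1 ω *
      (sigma ends a₁ a₂ b ω * Ffun ends o a₁ a₂ a₃ (gamma p ends o a₁ a₂ a₃) ω)) = _
  rw [key, expect_add_const_mul, h1, h2]
  rfl

omit [Fintype V] in
/-- **The fibre slack is the difference of the fibre covariance masses**, normalised by `m_W`:
`slack W / m_W = fibreCov_Q(σ_b, F) W − fibreCov_PD(1_{b∈U}, 1_{o∈U}) W` — every weight vector, every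
fibre (a null fibre gives `0 = 0 − 0`). -/
theorem slack_div_eq_fibreCov (p : E → ℝ) (hp : IsProbVec p) (ends : E → Sym2 V)
    (o a₁ a₂ a₃ b : V) (W : Finset V) :
    A3Fibre.slack p ends o a₁ a₂ a₃ b W / A3Fibre.mW p ends a₁ a₂ a₃ W =
      fibreCov p ends a₃ (avoidAll ends a₂ {a₁}) (sigma ends a₁ a₂ b)
          (Ffun ends o a₁ a₂ a₃ (gamma p ends o a₁ a₂ a₃)) W -
        fibreCov p ends a₃ (PDEvent ends a₁ a₂ a₃) (inU ends a₁ a₂ b) (inU ends a₁ a₂ o) W := by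
  by_cases hm : A3Fibre.mW p ends a₁ a₂ a₃ W = 0
  · have hQ : prob p (avoidAll ends a₂ {a₁} ∩ clusterEvent ends a₃ (↑W : Set V)) = 0 := by
      rw [prob_Q_inter_clusterEvent]
      exact hm
    have hPD : prob p (PDEvent ends a₁ a₂ a₃ ∩ clusterEvent ends a₃ (↑W : Set V)) = 0 := by
      rw [prob_PD_inter_clusterEvent]
      split_ifs <;> simp [hm]
    rw [hm, div_zero, fibreCov_eq_zero_of_prob_eq_zero hp ends a₃ _ _ _ W hQ,
      fibreCov_eq_zero_of_prob_eq_zero hp ends a₃ _ _ _ W hPD, sub_zero]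
  · unfold fibreCov
    rw [fibreExpect_Q_sigma_mul_F, fibreExpect_Q_sigma, fibreExpect_Q_F, prob_Q_inter_clusterEvent,
      fibreExpect_PD_eq, fibreExpect_PD_eq, fibreExpect_PD_eq, prob_PD_inter_clusterEvent]
    simp only [A3Fibre.slack]
    split_ifs with h
    · rw [fibreExpect_Q_inU_mul_inU, fibreExpect_Q_inU, fibreExpect_Q_inU]
      field_simp
    · field_simp
      ring

/-- **The within-cluster sum as fibre covariance masses**:
`∑_W slack W / m_W = ∑_W fibreCov_Q(σ_b, F) W − ∑_W fibreCov_PD(1_{b∈U}, 1_{o∈U}) W`. -/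
theorem sum_slack_div_eq_sum_fibreCov (p : E → ℝ) (hp : IsProbVec p) (ends : E → Sym2 V)
    (o a₁ a₂ a₃ b : V) :
    ∑ W : Finset V, A3Fibre.slack p ends o a₁ a₂ a₃ b W / A3Fibre.mW p ends a₁ a₂ a₃ W =
      ∑ W : Finset V, fibreCov p ends a₃ (avoidAll ends a₂ {a₁}) (sigma ends a₁ a₂ b)
          (Ffun ends o a₁ a₂ a₃ (gamma p ends o a₁ a₂ a₃)) W -
        ∑ W : Finset V, fibreCov p ends a₃ (PDEvent ends a₁ a₂ a₃) (inU ends a₁ a₂ b)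
          (inU ends a₁ a₂ o) W := by
  rw [← Finset.sum_sub_distrib]
  exact Finset.sum_congr rfl fun W _ => slack_div_eq_fibreCov p hp ends o a₁ a₂ a₃ b W

/-- **The within-cluster half in Mathlib's language**: for every weight vector,
`∑_W slack W / m_W = P(Q) · μ_Q[Cov(σ_b, F | 𝒢)] − P(PD) · μ_PD[Cov(1_{b∈U}, 1_{o∈U} | 𝒢)]`
with `𝒢 = σ(C(a₃))` — the mean conditional covariances, the companion of `btw_eq_covariance'`. -/
theorem sum_slack_div_eq_integral_condCovSigma (p : E → ℝ) (hp : IsProbVec p) (ends : E → Sym2 V)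
    (o a₁ a₂ a₃ b : V) :
    ∑ W : Finset V, A3Fibre.slack p ends o a₁ a₂ a₃ b W / A3Fibre.mW p ends a₁ a₂ a₃ W =
      prob p (avoidAll ends a₂ {a₁}) *
          ∫ ω, condCovSigma (clusterSigma ends a₃) (sigma ends a₁ a₂ b)
            (Ffun ends o a₁ a₂ a₃ (gamma p ends o a₁ a₂ a₃))
            ((percMeasureOf p hp)[|avoidAll ends a₂ {a₁}]) ω
            ∂((percMeasureOf p hp)[|avoidAll ends a₂ {a₁}]) -
        prob p (PDEvent ends a₁ a₂ a₃) *
          ∫ ω, condCovSigma (clusterSigma ends a₃) (inU ends a₁ a₂ b) (inU ends a₁ a₂ o)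
            ((percMeasureOf p hp)[|PDEvent ends a₁ a₂ a₃]) ω
            ∂((percMeasureOf p hp)[|PDEvent ends a₁ a₂ a₃]) := by
  rw [prob_mul_integral_condCovSigma, prob_mul_integral_condCovSigma,
    sum_slack_div_eq_sum_fibreCov p hp]

end Slack

/-! ## The law of total covariance on both sides of (HCOV) -/

section Total

variable {V : Type*} {E : Type*} [Fintype V] [DecidableEq V] [Fintype E] [DecidableEq E]

/-- **Law of total covariance** on the conditioned product measure, given the revealed cluster:
`cov[f, g; μ_A] = μ_A[Cov(f, g | 𝒢)] + cov[μ_A[f | 𝒢], μ_A[g | 𝒢]; μ_A]` — every weight vector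
(on a null `A` all three terms vanish). -/
theorem covariance_eq_integral_condCovSigma_add_covariance_condExp (p : E → ℝ) (hp : IsProbVec p)
    (ends : E → Sym2 V) (a₃ : V) (A : Set (Config E)) (f g : Config E → ℝ) :
    cov[f, g; (percMeasureOf p hp)[|A]] =
      (∫ ω, condCovSigma (clusterSigma ends a₃) f g ((percMeasureOf p hp)[|A]) ω
        ∂((percMeasureOf p hp)[|A])) +
      cov[((percMeasureOf p hp)[|A])[f | clusterSigma ends a₃],
        ((percMeasureOf p hp)[|A])[g | clusterSigma ends a₃]; (percMeasureOf p hp)[|A]] := by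
  by_cases hA : prob p A = 0
  · rw [cond_percMeasureOf_eq_zero p hp hA]
    simp
  · have hfg : ∑ W : Finset V, fibreExpect p ends a₃ A (fun ω => f ω * g ω) W =
        expect p (fun ω => A.indicator 1 ω * (f ω * g ω)) := sum_fibreExpect p ends a₃ A _
    have hf : ∑ W : Finset V, fibreExpect p ends a₃ A f W =
        expect p (fun ω => A.indicator 1 ω * f ω) := sum_fibreExpect p ends a₃ A f
    have hg : ∑ W : Finset V, fibreExpect p ends a₃ A g W =
        expect p (fun ω => A.indicator 1 ω * g ω) := sum_fibreExpect p ends a₃ A g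
    rw [covariance_congr_ae (condMean_ae_eq_condExp p hp ends a₃ A f).symm
        (condMean_ae_eq_condExp p hp ends a₃ A g).symm,
      integral_congr_ae (condCovSigma_ae_eq_condCovMean p hp ends a₃ A f g),
      covariance_cond_percMeasureOf p hp hA, covariance_cond_percMeasureOf p hp hA,
      integral_cond_percMeasureOf, expect_indicator_condCovMean hp, expect_indicator_condMean_mul,
      expect_indicator_condMean hp, expect_indicator_condMean hp, ← hfg, ← hf, ← hg]
    unfold fibreCov
    rw [Finset.sum_sub_distrib]
    ring

/-- **Within + between on both sides of (HCOV)**: for every weight vector,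
`∑_W slack W / m_W + btw = P(Q) · cov[σ_b, F; μ_Q] − P(PD) · cov[1_{b∈U}, 1_{o∈U}; μ_PD]` —
p5's within-cluster sum and the residual (MEANS-a₃) are the two halves of the law of total
covariance given `σ(C(a₃))` on the conditional covariances of `HCov_iff_covariance`. -/
theorem sum_slack_div_add_btw_eq_covariance (p : E → ℝ) (hp : IsProbVec p) (ends : E → Sym2 V)
    (o a₁ a₂ a₃ b : V) :
    (∑ W : Finset V, A3Fibre.slack p ends o a₁ a₂ a₃ b W / A3Fibre.mW p ends a₁ a₂ a₃ W) +
        A3Fibre.btw p ends o a₁ a₂ a₃ b =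
      prob p (avoidAll ends a₂ {a₁}) *
          cov[sigma ends a₁ a₂ b, Ffun ends o a₁ a₂ a₃ (gamma p ends o a₁ a₂ a₃);
            (percMeasureOf p hp)[|avoidAll ends a₂ {a₁}]] -
        prob p (PDEvent ends a₁ a₂ a₃) *
          cov[inU ends a₁ a₂ b, inU ends a₁ a₂ o; (percMeasureOf p hp)[|PDEvent ends a₁ a₂ a₃]] := by
  rw [sum_slack_div_eq_integral_condCovSigma p hp, btw_eq_covariance' p hp ends o a₁ a₂ a₃ b,
    covariance_eq_integral_condCovSigma_add_covariance_condExp p hp ends a₃ (avoidAll ends a₂ {a₁})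
      (sigma ends a₁ a₂ b) (Ffun ends o a₁ a₂ a₃ (gamma p ends o a₁ a₂ a₃)),
    covariance_eq_integral_condCovSigma_add_covariance_condExp p hp ends a₃ (PDEvent ends a₁ a₂ a₃)
      (inU ends a₁ a₂ b) (inU ends a₁ a₂ o)]
  ring

/-- **p5's a₃-exploration identity re-derived through the law of total covariance**:
`Gc = P(PD) · P(Q) · (∑_W slack W / m_W + btw)` from `Gc_eq_covariance` and
`sum_slack_div_add_btw_eq_covariance` — a second, measure-theoretic proof of
`A3FibreMain.Gc_eq_a3`. -/
theorem Gc_eq_a3_of_total_covariance (p : E → ℝ) (hp : IsProbVec p) (ends : E → Sym2 V)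
    (o a₁ a₂ a₃ b : V) :
    Gc p ends o a₁ a₂ a₃ b =
      prob p (PDEvent ends a₁ a₂ a₃) * prob p (avoidAll ends a₂ {a₁}) *
        ((∑ W : Finset V, A3Fibre.slack p ends o a₁ a₂ a₃ b W / A3Fibre.mW p ends a₁ a₂ a₃ W) +
          A3Fibre.btw p ends o a₁ a₂ a₃ b) := by
  rw [sum_slack_div_add_btw_eq_covariance p hp, Gc_eq_covariance p hp]
  ring

end Total

end A3Means

end CovForm

end Summit.Ventures.PercRepro2
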